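import Summits.AtomisticToContinuum.HydrodynamicLimit.Theorems.OneFlightGossipEngineEnergyCurrentTailsMarginalForm
import Summits.AtomisticToContinuum.HydrodynamicLimit.Theorems.OneFlightGossipEngineEnergyCurrentTailsQuarticDocking
import HarnessLib

/-!
# The quartic exergy bound: the weakest open stub of the line `IdeatorThreeSketch`
# (crux `EnergyCurrentTails`, stmt-AtomisticToContinuum-9235) and its docking

Helper file of the line lead (prover-line-stmt-AtomisticToContinuum-9235-0) for the registered stub
`stub_quarticInfluenceDocking` (reshape of cycle 1).

The card's transfer statement C⁺ (`stub_exergyInfluence`: a Gaussian envelope, tested against EVERY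
one-particle observable, of the planted-particle likelihood ratio under the homogeneous invariant law
`G`) is much stronger than what the crux consumes.  Keeping the card's lever — the Loschmidt tagging
identity, which moves the non-equilibrium into ONE explicit weight `F∘flip∘Φ_s` under the INVARIANT
law — but asking only for what the Chebyshev docking needs gives the QUARTIC EXERGY BOUND
(`stub_quarticInfluence`, OPEN, registered):

  `∫ |vᵢ|⁴ · F(flip(Φ_s z)) dG ≤ C`, uniformly in `N ≥ N₀`, `s ∈ [0,t]`, `i`,

i.e. (by `lintegral_mul_density_flipVel_flow`) a uniform quartic velocity moment `E_{λ_N}|vᵢ(s)|⁴ ≤ C`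
of the evolved local Gibbs law before the first shock.  This file proves
* `stub_quarticInfluenceDocking` (registered): the quartic exergy bound implies the crux — average over
  `i` and dock through the landed `stub_quarticDocking` (`M = |C|/ε + 1`);
* `quarticInfluence_of_exergyInfluence`: the card's C⁺ implies the quartic exergy bound (test C⁺ with
  `g = |·|⁴`; the tilted quartic Gaussian moment is finite, `lintegral_norm_pow_four_mul_exp_lt_top`),
  so the reshaped skeleton's single open stub is WEAKER than the card's, with the same lever.

References: Olla–Varadhan–Yau 1993 §1; Spohn 1991 Part I Ch. 3; CIP 1994 §4.2.
-/

noncomputable section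

open MeasureTheory Set Filter
open scoped ENNReal

namespace Summit.AtomisticToContinuum.HydrodynamicLimit.Theorems.LoschmidtTagging

open Literature.MathematicalPhysics.KineticTheory Literature.Analysis.FluidPDE

/-- **Registered stub `stub_quarticInfluenceDocking`** (line `IdeatorThreeSketch`, crux
stmt-AtomisticToContinuum-9235): the QUARTIC EXERGY BOUND — for `N ≥ N₀`, `s ≤ t`, a density
`F = dλ_N/dG` w.r.t. a homogeneous reference `G = localGibbsLaw σ a 0 θr` with
`∫ |vᵢ|⁴ F(flip Φ_s z) dG ≤ C` for every particle `i` — implies `OneFlightGossipEngine.EnergyCurrentTails`.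
Proof: the tested quartic functional IS `E_{λ_N}|vᵢ(s)|⁴` (`lintegral_mul_density_flipVel_flow` with
`g = |·|⁴`, even), so the empirical quartic moment is `≤ C`, and the landed quartic docking applies. -/
theorem stub_quarticInfluenceDocking :
    (∀ (a₀ θ₀ : T3 → ℝ) (u₀ : T3 → V3), Continuous a₀ → Continuous θ₀ → Continuous u₀ →
      (∀ x, 0 < a₀ x) → (∀ x, 0 < θ₀ x) →
      ∃ σ₀ : ℝ, 0 < σ₀ ∧ ∀ σ : ℝ, 0 < σ → σ < σ₀ →
        ∀ (T : ℝ) (ρ θ : ℝ → T3 → ℝ) (u : ℝ → T3 → V3), IsHardSphereEulerSolution σ T ρ u θ →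
          ∀ Φ : (N : ℕ) → HardSphereFlow (Torus.geometry (Fin 3)) (hsDiameter σ N) (N + 1),
            TendstoHydroFieldsAt (fun N => localGibbsLaw σ a₀ u₀ θ₀ N (Φ N)) Φ ρ u θ 0 →
              ∀ t ∈ Set.Ico 0 T, ∃ a θr C : ℝ, 0 < a ∧ 0 < θr ∧ 0 ≤ C ∧
                ∃ N₀ : ℕ, ∀ N : ℕ, N₀ ≤ N → ∀ s ∈ Set.Icc 0 t,
                  ∃ F : Config (N + 1) (Fin 3) T3 → ℝ≥0∞, Measurable F ∧
                    localGibbsLaw σ a₀ u₀ θ₀ N (Φ N)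
                      = (localGibbsLaw σ (fun _ => a) (fun _ => 0) (fun _ => θr) N (Φ N)).withDensity F ∧
                    ∀ i : Fin (N + 1),
                      ∫⁻ z, ENNReal.ofReal (‖(z i).2‖ ^ 4) * F (flipVel ((Φ N).flow s z))
                          ∂(localGibbsLaw σ (fun _ => a) (fun _ => 0) (fun _ => θr) N (Φ N))
                        ≤ ENNReal.ofReal C) →
    Summit.AtomisticToContinuum.HydrodynamicLimit.Theses.OneFlightGossipEngine.EnergyCurrentTails := by
  intro hQI
  refine stub_quarticDocking ?_
  intro a₀ θ₀ u₀ ha hθ hu ha0 hθ0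
  obtain ⟨σ₀, hσ₀, H⟩ := hQI a₀ θ₀ u₀ ha hθ hu ha0 hθ0
  refine ⟨σ₀, hσ₀, fun σ hσ hσlt T ρ θ u hE Φ h0 t ht => ?_⟩
  obtain ⟨a, θr, C, _ha, _hθr, hC, N₀, HN⟩ := H σ hσ hσlt T ρ θ u hE Φ h0 t ht
  refine ⟨C, N₀, fun N hN s hs => ?_⟩
  obtain ⟨F, hFm, hFeq, Hi⟩ := HN N hN s hs
  -- the quartic observable, as an `ℝ≥0∞`-valued one-particle function
  have hg : Measurable fun w : V3 => ENNReal.ofReal (‖w‖ ^ 4) :=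
    (measurable_norm.pow_const 4).ennreal_ofReal
  -- each particle's quartic moment under the evolved law is the tested functional, hence `≤ C`
  have hpart : ∀ i : Fin (N + 1),
      ∫⁻ w, ENNReal.ofReal (‖((Φ N).flow s w i).2‖ ^ 4) ∂(localGibbsLaw σ a₀ u₀ θ₀ N (Φ N))
        ≤ ENNReal.ofReal C := by
    intro i
    have hid := lintegral_mul_density_flipVel_flow σ a θr N (Φ N) hFm hg s i
    simp only [norm_neg] at hid
    rw [← hFeq] at hid
    rw [← hid]
    exact Hi i
  -- sum over particles
  have hvel : ∀ i : Fin (N + 1), Measurable fun w : Config (N + 1) (Fin 3) T3 =>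
      ENNReal.ofReal (‖((Φ N).flow s w i).2‖ ^ 4) := fun i =>
    hg.comp (measurable_snd.comp ((measurable_pi_apply i).comp ((Φ N).measurable_flow s)))
  have hpt : ∀ z : Config (N + 1) (Fin 3) T3,
      ENNReal.ofReal (((N : ℝ) + 1)⁻¹ * ∑ i : Fin (N + 1), ‖((Φ N).flow s z i).2‖ ^ 4) =
        ENNReal.ofReal (((N : ℝ) + 1)⁻¹) *
          ∑ i : Fin (N + 1), ENNReal.ofReal (‖((Φ N).flow s z i).2‖ ^ 4) := by
    intro z
    rw [ENNReal.ofReal_mul (by positivity), ENNReal.ofReal_sum_of_nonneg fun i _ => by positivity]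
  have hN : ENNReal.ofReal (((N : ℝ) + 1)⁻¹) * ((N + 1 : ℕ) : ℝ≥0∞) = 1 := by
    rw [ENNReal.ofReal_inv_of_pos (by positivity)]
    have : ENNReal.ofReal ((N : ℝ) + 1) = ((N + 1 : ℕ) : ℝ≥0∞) := by
      rw [show ((N : ℝ) + 1) = ((N + 1 : ℕ) : ℝ) by push_cast; ring, ENNReal.ofReal_natCast]
    rw [this]
    exact ENNReal.inv_mul_cancel (by simp) (ENNReal.natCast_ne_top _)
  calc ∫⁻ z, ENNReal.ofReal (((N : ℝ) + 1)⁻¹ * ∑ i : Fin (N + 1), ‖((Φ N).flow s z i).2‖ ^ 4)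
        ∂(localGibbsLaw σ a₀ u₀ θ₀ N (Φ N))
      = ∫⁻ z, ENNReal.ofReal (((N : ℝ) + 1)⁻¹) *
          ∑ i : Fin (N + 1), ENNReal.ofReal (‖((Φ N).flow s z i).2‖ ^ 4)
          ∂(localGibbsLaw σ a₀ u₀ θ₀ N (Φ N)) := lintegral_congr fun z => hpt z
    _ = ENNReal.ofReal (((N : ℝ) + 1)⁻¹) *
          ∫⁻ z, ∑ i : Fin (N + 1), ENNReal.ofReal (‖((Φ N).flow s z i).2‖ ^ 4)
            ∂(localGibbsLaw σ a₀ u₀ θ₀ N (Φ N)) :=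
        lintegral_const_mul _ (Finset.measurable_sum _ fun i _ => hvel i)
    _ = ENNReal.ofReal (((N : ℝ) + 1)⁻¹) *
          ∑ i : Fin (N + 1), ∫⁻ z, ENNReal.ofReal (‖((Φ N).flow s z i).2‖ ^ 4)
            ∂(localGibbsLaw σ a₀ u₀ θ₀ N (Φ N)) := by
        congr 1
        exact lintegral_finsetSum _ fun i _ => hvel i
    _ ≤ ENNReal.ofReal (((N : ℝ) + 1)⁻¹) * ∑ _i : Fin (N + 1), ENNReal.ofReal C := by
        gcongr with i
        exact hpart i
    _ = ENNReal.ofReal C := by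
        rw [Finset.sum_const, Finset.card_univ, Fintype.card_fin, nsmul_eq_mul, ← mul_assoc, hN,
          one_mul]

/-- **The card's C⁺ implies the quartic exergy bound** (so the reshaped skeleton's open stub is
weaker): test the exergy influence bound with `g = |·|⁴`; the right-hand side is
`C ∫ |w|⁴ e^{β|w|²/2} N(0,θr)(dw) < ∞` (`βθr < 1`, `lintegral_norm_pow_four_mul_exp_lt_top`), after
shrinking `σ₀` to `≤ 1/2` so that the reference law is a probability measure
(`lintegral_vel_localGibbsLaw_const`). -/
theorem quarticInfluence_of_exergyInfluence
    (hEX : ∀ (a₀ θ₀ : T3 → ℝ) (u₀ : T3 → V3), Continuous a₀ → Continuous θ₀ → Continuous u₀ →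
      (∀ x, 0 < a₀ x) → (∀ x, 0 < θ₀ x) →
      ∃ σ₀ : ℝ, 0 < σ₀ ∧ ∀ σ : ℝ, 0 < σ → σ < σ₀ →
        ∀ (T : ℝ) (ρ θ : ℝ → T3 → ℝ) (u : ℝ → T3 → V3), IsHardSphereEulerSolution σ T ρ u θ →
          ∀ Φ : (N : ℕ) → HardSphereFlow (Torus.geometry (Fin 3)) (hsDiameter σ N) (N + 1),
            TendstoHydroFieldsAt (fun N => localGibbsLaw σ a₀ u₀ θ₀ N (Φ N)) Φ ρ u θ 0 →
              ∀ t ∈ Set.Ico 0 T, ∃ a θr β C : ℝ, 0 < a ∧ 0 < θr ∧ β * θr < 1 ∧ 0 ≤ C ∧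
                ∃ N₀ : ℕ, ∀ N : ℕ, N₀ ≤ N → ∀ s ∈ Set.Icc 0 t,
                  ∃ F : Config (N + 1) (Fin 3) T3 → ℝ≥0∞, Measurable F ∧
                    localGibbsLaw σ a₀ u₀ θ₀ N (Φ N)
                      = (localGibbsLaw σ (fun _ => a) (fun _ => 0) (fun _ => θr) N (Φ N)).withDensity F ∧
                    ∀ (i : Fin (N + 1)) (g : V3 → ℝ≥0∞), Measurable g →
                      ∫⁻ z, g ((z i).2) * F (flipVel ((Φ N).flow s z))
                          ∂(localGibbsLaw σ (fun _ => a) (fun _ => 0) (fun _ => θr) N (Φ N))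
                        ≤ ENNReal.ofReal C *
                          ∫⁻ z, g ((z i).2) * ENNReal.ofReal (Real.exp (β * ‖(z i).2‖ ^ 2 / 2))
                            ∂(localGibbsLaw σ (fun _ => a) (fun _ => 0) (fun _ => θr) N (Φ N))) :
    ∀ (a₀ θ₀ : T3 → ℝ) (u₀ : T3 → V3), Continuous a₀ → Continuous θ₀ → Continuous u₀ →
      (∀ x, 0 < a₀ x) → (∀ x, 0 < θ₀ x) →
      ∃ σ₀ : ℝ, 0 < σ₀ ∧ ∀ σ : ℝ, 0 < σ → σ < σ₀ →
        ∀ (T : ℝ) (ρ θ : ℝ → T3 → ℝ) (u : ℝ → T3 → V3), IsHardSphereEulerSolution σ T ρ u θ →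
          ∀ Φ : (N : ℕ) → HardSphereFlow (Torus.geometry (Fin 3)) (hsDiameter σ N) (N + 1),
            TendstoHydroFieldsAt (fun N => localGibbsLaw σ a₀ u₀ θ₀ N (Φ N)) Φ ρ u θ 0 →
              ∀ t ∈ Set.Ico 0 T, ∃ a θr C : ℝ, 0 < a ∧ 0 < θr ∧ 0 ≤ C ∧
                ∃ N₀ : ℕ, ∀ N : ℕ, N₀ ≤ N → ∀ s ∈ Set.Icc 0 t,
                  ∃ F : Config (N + 1) (Fin 3) T3 → ℝ≥0∞, Measurable F ∧
                    localGibbsLaw σ a₀ u₀ θ₀ N (Φ N)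
                      = (localGibbsLaw σ (fun _ => a) (fun _ => 0) (fun _ => θr) N (Φ N)).withDensity F ∧
                    ∀ i : Fin (N + 1),
                      ∫⁻ z, ENNReal.ofReal (‖(z i).2‖ ^ 4) * F (flipVel ((Φ N).flow s z))
                          ∂(localGibbsLaw σ (fun _ => a) (fun _ => 0) (fun _ => θr) N (Φ N))
                        ≤ ENNReal.ofReal C := by
  intro a₀ θ₀ u₀ ha hθ hu ha0 hθ0
  obtain ⟨σ₀, hσ₀, H⟩ := hEX a₀ θ₀ u₀ ha hθ hu ha0 hθ0
  refine ⟨min σ₀ (1 / 2), lt_min hσ₀ (by norm_num), ?_⟩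
  intro σ hσ hσlt T ρ θ u hE Φ h0 t ht
  have hσ₀' : σ < σ₀ := lt_of_lt_of_le hσlt (min_le_left _ _)
  have hσ2 : σ ≤ 1 / 2 := (lt_of_lt_of_le hσlt (min_le_right _ _)).le
  obtain ⟨a, θr, β, C, ha', hθr, hβ, hC, N₀, HN⟩ := H σ hσ hσ₀' T ρ θ u hE Φ h0 t ht
  -- the finite tilted quartic Gaussian moment
  set K₄ : ℝ≥0∞ := ∫⁻ w, ENNReal.ofReal (‖w‖ ^ 4) * ENNReal.ofReal (Real.exp (β * ‖w‖ ^ 2 / 2))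
    ∂(gaussMeasure (0 : V3) θr) with hK₄
  have hK₄top : K₄ ≠ ⊤ := (lintegral_norm_pow_four_mul_exp_lt_top hθr hβ).ne
  refine ⟨a, θr, C * K₄.toReal, ha', hθr, mul_nonneg hC ENNReal.toReal_nonneg, N₀,
    fun N hN s hs => ?_⟩
  obtain ⟨F, hFm, hFeq, Hg⟩ := HN N hN s hs
  refine ⟨F, hFm, hFeq, fun i => ?_⟩
  have hg : Measurable fun w : V3 => ENNReal.ofReal (‖w‖ ^ 4) :=
    (measurable_norm.pow_const 4).ennreal_ofReal
  have hHm : Measurable (fun w : V3 =>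
      ENNReal.ofReal (‖w‖ ^ 4) * ENNReal.ofReal (Real.exp (β * ‖w‖ ^ 2 / 2))) :=
    hg.mul (((measurable_norm.pow_const 2).const_mul β).div_const 2).exp.ennreal_ofReal
  have key := Hg i (fun w => ENNReal.ofReal (‖w‖ ^ 4)) hg
  rw [lintegral_vel_localGibbsLaw_const hσ2 ha' hθr N (Φ N) i hHm] at key
  calc ∫⁻ z, ENNReal.ofReal (‖(z i).2‖ ^ 4) * F (flipVel ((Φ N).flow s z))
          ∂(localGibbsLaw σ (fun _ => a) (fun _ => 0) (fun _ => θr) N (Φ N))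
      ≤ ENNReal.ofReal C * K₄ := key
    _ = ENNReal.ofReal (C * K₄.toReal) := by
        rw [ENNReal.ofReal_mul hC, ENNReal.ofReal_toReal hK₄top]

end Summit.AtomisticToContinuum.HydrodynamicLimit.Theorems.LoschmidtTagging

end
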